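import Summits.BirchSwinnertonDyer.BirchSwinnertonDyer.Theorems.KatoDescentPotSupersingularUnramifiedTrivialOverTower
import Summits.BirchSwinnertonDyer.BirchSwinnertonDyer.Theorems.KatoDescentPotSupersingularTowerFineControl
import Literature.NumberTheory.EllipticCurves.Kato2004.StrictSelmerH2Count
import Literature.NumberTheory.EllipticCurves.FineSelmerCoefficientMapProofs
import Literature.NumberTheory.EllipticCurves.IwasawaSelmerDualProofs
import Literature.NumberTheory.EllipticCurves.SubgroupSelmerProofs
import Literature.NumberTheory.EllipticCurves.BSDConductorProofs
import Literature.NumberTheory.GaloisRepresentations.ContinuousH1OrderTwo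
import Literature.NumberTheory.GaloisRepresentations.TateH2VanishingArchimedean
import HarnessLib

/-!
# EXACT FINE CONTROL at level `0`, part 1 (LOCAL CONDITIONS): on the rows with `W(ℚ_p)[p] = 0` the
# restriction to `ℚ_∞` of a class of `H¹(ℚ, W[p^∞])` is FINE iff the class is STRICT in Kato's sense
# (trivial at `p`, unramified off `p`) — the level-`0` local dictionary behind
# `Sel_str(ℚ, W[p^∞]) ≅ Sel₀(ℚ_∞, W[p^∞])^Γ` (sequel: `…ExactFineControl.lean`; crux M 19196)

Seat `bsd-potss-rkm` g27 (prover, cell `bsd-potss`), `--supports stmt-BirchSwinnertonDyer-19196 --as helper`;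
route-free; closes nothing.  HONEST FRAMING: BSD is not proved by any of this; nothing is booked; crux M
stays cite-level on {modularity, 27962}; theorems only (no definition, no named fact, no `sorry`).

## What and why

Memo FINDING-19196-rkm-g26 §3b: on every row of crux M with `W(ℚ_p)[p] = 0` (all (t′) rows at `p ≥ 11`;
`p ∈ {5,7}` off Kodaira II/III) Kato's `𝐇²_{Γ,loc}(T_pW) = 0`, so `𝐇²_Γ(T_pW) = X₀(W/ℚ_∞)` is the
Pontryagin dual of the fine Selmer group `Sel₀(ℚ_∞, W[p^∞])` (tree `fineSelmerInfty`), and the count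
clause (c2′) `#(𝐇²/X𝐇²)·#W(ℚ)[p^∞] = #Sel_str(ℚ,W[p^∞])·#W(ℚ_p)[p^∞]` of the held package
`Kato2004.exists_memberHullZetaCoreInputs` becomes `#(X₀)_Γ = #Sel_str(ℚ, W[p^∞])`, `Sel_str = katoStrictSelmer
W p {v_p}` (Kato (14.9.3): unramified off `p`, trivial at `p`).  The sequel `KatoDescentPotSupersingularExactFineControl`
proves it as an isomorphism `res : Sel_str(ℚ, W[p^∞]) ⥲ Sel₀(ℚ_∞, W[p^∞])^Γ`; THIS FILE supplies the local
dictionary at level `0` (`p` odd, `κ` cyclotomic, `W(ℚ_p)[p] = 0`):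

* §1–§2 bridges (`H¹(Γ_K,·) → H¹(S,·) → H¹(D,·)`; `H¹(H ⊓ D_w, W[p^∞]) = 0` at infinite `w` for `p` odd);
* §3 the local conditions of `Sel₀(ℚ_∞)` on a level-`0` class `y ∈ H¹(κ⁻¹(ℤ_p), W[p^∞]) = H¹(ℚ, W[p^∞])`:
  conjugates coincide (`conjH1_layerToInfty_zero`); at `ℓ ≠ p` «trivial on `Gal(ℚ̄/ℚ_∞) ⊓ D_ℓ` ⟺ unramified
  at `ℓ`» (`UnramifiedTrivialOverTower`, p661628: the pro-`p′` group `Gal(ℚ̄_ℓ/ℚ_{∞,w})/I_ℓ` has no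
  `p`-primary `H¹`); at `p` «trivial on `Gal(ℚ̄/ℚ_∞) ⊓ D_p` ⟺ trivial on `D_p`» (p659030 (b),
  `W(ℚ_{p,∞})[p^∞] = 0`); assembled: **`layerToInfty_mem_fineSelmerInfty_iff`** — `res y ∈ Sel₀(ℚ_∞, W[p^∞])`
  iff `res_{D_p} y = 0` and `res_{I_v} y = 0` for all `v ≠ v_p`.

References: K. Kato, Astérisque 295 (2004), §8.2, §14.1, (14.9.3) p. 240, (14.14.2) p. 243 [Kato2004Asterisque];
R. Greenberg, LNM 1716 (1999), §3 Lemmas 3.1–3.3, Prop. 3.8 (pp. 86–96), §4 [GreenbergLNM1716]; R. Greenberg,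
V. Vatsal, Invent. Math. 142 (2000) §2 Prop. (2.4) [GreenbergVatsal2000]; J.-P. Serre, *Galois Cohomology*
(1997) I.§2.4–2.6 [SerreGaloisCohomology1997]; J. Coates, R. Sujatha, Math. Ann. 331 (2005) §3 [CoatesSujatha2005].
-/

-- the summit and its single problem are both named `BirchSwinnertonDyer` (registry layout D-0017)
set_option linter.dupNamespace false
set_option autoImplicit false

noncomputable section

open scoped Classical NumberField
open Function Field NumberField IsDedekindDomain
open Literature.NumberTheory.EllipticCurves Literature.NumberTheory.EllipticCurves.GreenbergSelmer
  Literature.NumberTheory.EllipticCurves.ZpExtension Literature.NumberTheory.EllipticCurves.Kato2004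
  Literature.NumberTheory.GaloisRepresentations
open Summit.BirchSwinnertonDyer.BirchSwinnertonDyer.Theorems
  Summit.BirchSwinnertonDyer.BirchSwinnertonDyer.Theorems.FineSelmerLeSignedSelmer

universe u

namespace Summit.BirchSwinnertonDyer.BirchSwinnertonDyer.Theorems.ExactFineControlLocal

/-! ## §1 Dialect bridges: `H¹(Γ_K, M) → H¹(S, M) → H¹(D, M)` -/

section Bridge

variable {G : Type u} [Group G] [TopologicalSpace G] [IsTopologicalGroup G]
  {M : Type u} [AddCommGroup M] [DistribMulAction G M] [TopologicalSpace M] [DiscreteTopology M]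

/-- Restricting `H¹(G, M) → H¹(S, M)` further to `D ≤ S` is the restriction `H¹(G, M) → H¹(D, M)`
(functoriality of `H¹` in compatible pairs). [cite: SerreGaloisCohomology1997, I.§2.4] -/
theorem resOfLe_resH1Hom_subgroupIncl {D S : Subgroup G} (h : D ≤ S) (y : discreteH1 G M) :
    resOfLe M h (resH1Hom (Literature.NumberTheory.EllipticCurves.subgroupIncl S) (AddMonoidHom.id M) (fun _ _ ↦ rfl) y) =
      resH1Hom (Literature.NumberTheory.EllipticCurves.subgroupIncl D) (AddMonoidHom.id M) (fun _ _ ↦ rfl) y := by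
  rw [resOfLe, resH1Hom_resH1Hom]
  have e : resH1Hom ((Literature.NumberTheory.EllipticCurves.subgroupIncl S).comp (subgroupInclusion h))
      ((AddMonoidHom.id M).comp (AddMonoidHom.id M)) (fun _ _ ↦ rfl) =
      resH1Hom (Literature.NumberTheory.EllipticCurves.subgroupIncl D) (AddMonoidHom.id M) (fun _ _ ↦ rfl) :=
    resH1Hom_congr (by ext; rfl) (by ext; rfl) _ _
  rw [e]

/-- Membership in `subgroupResKer M D` is the vanishing of the restriction to `D`. [folklore] -/
theorem mem_subgroupResKer_iff (D : Subgroup G) (y : discreteH1 G M) :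
    y ∈ subgroupResKer M D ↔ resH1Hom (Literature.NumberTheory.EllipticCurves.subgroupIncl D) (AddMonoidHom.id M) (fun _ _ ↦ rfl) y = 0 := by
  rw [subgroupResKer, resKer_eq_ker, AddMonoidHom.mem_ker]

end Bridge

/-! ## §2 The archimedean condition is vacuous for `p` odd -/

section Arch

variable {K : Type u} [Field K] [NumberField K] (W : WeierstrassCurve K) {p : ℕ} [hp : Fact p.Prime]

/-- **For `p` odd, `H¹(H ⊓ D_w, W[p^∞]) = 0` at every infinite place `w`**: the group `H ⊓ D_w` has order
`≤ 2` and every class is killed by a power of the odd prime `p`.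
[cite: SerreGaloisCohomology1997, I §2.4 (Cor. of Prop. 9)] [cite: GreenbergLNM1716, §4 (before Lemma 4.6)] -/
theorem subgroupH1_inf_decompInf_eq_zero (hp2 : p ≠ 2) (H : Subgroup (absoluteGaloisGroup K))
    (w : InfinitePlace K) (z : W.subgroupH1 p (H ⊓ decompInf w)) : z = 0 := by
  haveI := finite_absoluteGaloisGroup_completion_infinitePlace w
  have hsurj : ∀ g : (H ⊓ decompInf w : Subgroup (absoluteGaloisGroup K)),
      ∃ τ : absoluteGaloisGroup w.Completion, absGaloisRestrict K w.Completion τ = g := fun g ↦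
    (Subgroup.mem_inf.mp g.2).2
  choose lift hlift using hsurj
  have hinj : Function.Injective lift := fun g g' h ↦ by
    apply Subtype.ext
    rw [← hlift g, ← hlift g', h]
  haveI : Finite (H ⊓ decompInf w : Subgroup (absoluteGaloisGroup K)) := Finite.of_injective lift hinj
  have hcard : Nat.card (H ⊓ decompInf w : Subgroup (absoluteGaloisGroup K)) ≤ 2 :=
    (Nat.card_le_card_of_injective lift hinj).trans
      (natCard_absoluteGaloisGroup_completion_infinitePlace_le_two w)
  obtain ⟨φ, rfl⟩ := oneCocycleClass_surjective _ z
  obtain ⟨k, hk⟩ := IwasawaDual.exists_pow_smul_oneCocycleClass_eq_zero (p := p) φ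
    fun g ↦ exists_pow_smul_geomPrimaryTorsion_eq_zero W (φ.1 g)
  exact eq_zero_of_odd_nsmul_eq_zero_of_natCard_le_two hcard _ ((hp.out.odd_of_ne_two hp2).pow) _ hk

end Arch

/-! ## §3 Level `0` over `ℚ`: the local conditions of `Sel₀(ℚ_∞)` on a restricted class -/

section Rat

/-- A rational prime `p` lies in the finite place `v` of `ℚ` iff `v = primePlace p`. [folklore] -/
theorem natCast_mem_asIdeal_iff_eq_primePlace (p : ℕ) [hp : Fact p.Prime] (v : HeightOneSpectrum (𝓞 ℚ)) :
    ((p : ℕ) : 𝓞 ℚ) ∈ v.asIdeal ↔ v = primePlace p :=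
  natCast_mem_asIdeal_iff_eq_primesEquiv_symm v hp.out

variable (W : WeierstrassCurve ℚ) [W.IsElliptic] {p : ℕ} [hp : Fact p.Prime] (κ : ZpExtension ℚ p)

/-- Every subgroup of `Γ_ℚ` lies in the layer-`0` subgroup `κ⁻¹(ℤ_p) = Γ_ℚ`. [folklore] -/
theorem le_layerSubgroup_zero (D : Subgroup (absoluteGaloisGroup ℚ)) : D ≤ κ.layerSubgroup 0 :=
  le_top.trans_eq κ.layerSubgroup_zero.symm

omit [W.IsElliptic] in
/-- Conjugation acts trivially on the classes of `H¹(ℚ_∞, W[p^∞])` restricted from `ℚ = ℚ_0`.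
[cite: SerreGaloisCohomology1997, I.§2.5 and I.§5.1] -/
theorem conjH1_layerToInfty_zero (σ : absoluteGaloisGroup ℚ) (y : W.subgroupH1 p (κ.layerSubgroup 0)) :
    W.conjH1 p κ.kerSubgroup σ (W.layerToInfty κ 0 y) = W.layerToInfty κ 0 y := by
  have h := congrArg (fun f ↦ f y)
    (resOfLe_comp_conjH1_holds (M := W.geomPrimaryTorsion p) (κ.kerSubgroup_le_layerSubgroup 0) σ)
  simp only [AddMonoidHom.coe_comp, Function.comp_apply] at h
  change W.conjH1 p κ.kerSubgroup σ (W.resOfLe p (κ.kerSubgroup_le_layerSubgroup 0) y) = _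
  rw [← h, conjH1_of_mem_holds (κ.layerSubgroup 0) (W.geomPrimaryTorsion p)
    (le_layerSubgroup_zero κ ⊤ (Subgroup.mem_top σ)), AddMonoidHom.id_apply]
  rfl

omit [W.IsElliptic] in
/-- **The level-`0` local condition at `ℓ ≠ p` IS unramifiedness** (`κ` cyclotomic): for a class `y`
of `H¹(ℚ_0, W[p^∞]) = H¹(ℚ, W[p^∞])` and a finite place `v ∤ p`, the restriction of `y` to
`Gal(ℚ̄/ℚ_∞) ⊓ D_v` vanishes iff its restriction to the inertia group `I_v` vanishes.
[cite: GreenbergVatsal2000, §2 Prop. (2.4)] [cite: Kato2004Asterisque, §8.2 (p. 181) and (14.9.3) (p. 240)] -/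
theorem resOfLe_kerSubgroup_inf_decomp_eq_zero_iff_resOfLe_inertia_eq_zero (hκ : κ.IsCyclotomic)
    {v : HeightOneSpectrum (𝓞 ℚ)} (hv : ((p : ℕ) : 𝓞 ℚ) ∉ v.asIdeal)
    (y : W.subgroupH1 p (κ.layerSubgroup 0)) :
    W.resOfLe p (le_layerSubgroup_zero κ (κ.kerSubgroup ⊓ decomp v)) y = 0 ↔
      W.resOfLe p (le_layerSubgroup_zero κ (GreenbergSelmer.inertia v)) y = 0 := by
  have hIN : GreenbergSelmer.inertia v ≤ κ.kerSubgroup ⊓ decomp v :=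
    le_inf (greenbergInertia_le_kerSubgroup_of_isCyclotomic κ hκ hv) (inertia_le_decomp v)
  constructor
  · intro h
    have e := congrArg (fun f ↦ f y) (W.resOfLe_comp_holds p hIN
      (le_layerSubgroup_zero κ (κ.kerSubgroup ⊓ decomp v)))
    simp only [AddMonoidHom.coe_comp, Function.comp_apply] at e
    rw [← e, h, map_zero]
  · intro h
    exact UnramifiedTrivialOverTower.resOfLe_kerSubgroup_inf_decomp_eq_zero_of_resOfLe_inertia_eq_zero κ hκ
      hv (W.continuous_smul_geomPrimaryTorsion p) (exists_pow_smul_geomPrimaryTorsion_eq_zero W)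
      (le_layerSubgroup_zero κ _) (le_layerSubgroup_zero κ _) y h

/-- **The level-`0` local condition at `p` IS Kato's strict condition** when `W(ℚ_p)[p] = 0`: for a class
`y` of `H¹(ℚ, W[p^∞])` the restriction to `Gal(ℚ̄/ℚ_∞) ⊓ D_p` vanishes iff the restriction to `D_p`
vanishes (p659030 (b) for `⟸`). [cite: GreenbergLNM1716, §3 p. 96 (Prop. 3.8)] [cite: Kato2004Asterisque, (14.9.3) (p. 240)] -/
theorem resOfLe_kerSubgroup_inf_decomp_eq_zero_iff_resOfLe_decomp_eq_zero
    (h4 : ∀ R : (W.baseChange ℚ_[p]).toAffine.Point, p • R = 0 → R = 0)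
    (y : W.subgroupH1 p (κ.layerSubgroup 0)) :
    W.resOfLe p (le_layerSubgroup_zero κ (κ.kerSubgroup ⊓ decomp (primePlace p))) y = 0 ↔
      W.resOfLe p (le_layerSubgroup_zero κ (decomp (primePlace p))) y = 0 := by
  constructor
  · intro h
    have h1 := TowerFineControl.resOfLe_inf_decomp_eq_zero_of_resOfLe_kerSubgroup_inf_decomp_eq_zero W p κ
      (primePlace p) (coe_primesEquiv_primePlace p) h4 (y := y) h
    have hle : decomp (primePlace p) ≤ κ.layerSubgroup 0 ⊓ decomp (primePlace p) :=
      le_inf (le_layerSubgroup_zero κ _) le_rfl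
    have e := congrArg (fun f ↦ f y) (W.resOfLe_comp_holds p hle
      (inf_le_left : κ.layerSubgroup 0 ⊓ decomp (primePlace p) ≤ κ.layerSubgroup 0))
    simp only [AddMonoidHom.coe_comp, Function.comp_apply] at e
    rw [← e, h1, map_zero]
  · intro h
    have e := congrArg (fun f ↦ f y) (W.resOfLe_comp_holds p
      (inf_le_right : κ.kerSubgroup ⊓ decomp (primePlace p) ≤ decomp (primePlace p))
      (le_layerSubgroup_zero κ (decomp (primePlace p))))
    simp only [AddMonoidHom.coe_comp, Function.comp_apply] at e
    rw [← e, h, map_zero]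

/-- **Level-`0` fine membership.** For `p` odd, `κ` cyclotomic and `W(ℚ_p)[p] = 0`, the restriction to
`ℚ_∞` of a class `y ∈ H¹(ℚ, W[p^∞])` lies in the fine Selmer group `Sel₀(ℚ_∞, W[p^∞])` iff `y` is locally
trivial at `p` and unramified at every `ℓ ≠ p` (Kato's strict conditions): conjugates of a level-`0`
class coincide with it, the archimedean condition is empty for `p` odd, and the two finite local
conditions are the previous two theorems. [cite: Kato2004Asterisque, §14.1 (p. 235) and (14.9.3) (p. 240)]
[cite: GreenbergLNM1716, Prop. 3.8 (pp. 95–96)] -/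
theorem layerToInfty_mem_fineSelmerInfty_iff (hp2 : p ≠ 2) (hκ : κ.IsCyclotomic)
    (h4 : ∀ R : (W.baseChange ℚ_[p]).toAffine.Point, p • R = 0 → R = 0)
    (y : W.subgroupH1 p (κ.layerSubgroup 0)) :
    W.layerToInfty κ 0 y ∈ W.fineSelmerInfty κ ↔
      W.resOfLe p (le_layerSubgroup_zero κ (decomp (primePlace p))) y = 0 ∧
        ∀ v : HeightOneSpectrum (𝓞 ℚ), v ≠ primePlace p →
          W.resOfLe p (le_layerSubgroup_zero κ (GreenbergSelmer.inertia v)) y = 0 := by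
  have hres : ∀ v : HeightOneSpectrum (𝓞 ℚ),
      resOfLe (W.geomPrimaryTorsion p) (inf_le_left : κ.kerSubgroup ⊓ decomp v ≤ κ.kerSubgroup)
          (W.layerToInfty κ 0 y) =
        W.resOfLe p (le_layerSubgroup_zero κ (κ.kerSubgroup ⊓ decomp v)) y := fun v ↦ by
    have e := congrArg (fun f ↦ f y) (W.resOfLe_comp_holds p
      (inf_le_left : κ.kerSubgroup ⊓ decomp v ≤ κ.kerSubgroup) (κ.kerSubgroup_le_layerSubgroup 0))
    simp only [AddMonoidHom.coe_comp, Function.comp_apply] at e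
    exact e
  rw [WeierstrassCurve.fineSelmerInfty, FineSelmerCoefficientMap.mem_fineSelmerInfty_iff_resOfLe]
  simp only [conjH1_layerToInfty_zero]  -- conjugates of a level-0 class
  constructor
  · rintro ⟨hfin, -⟩
    refine ⟨?_, fun v hv ↦ ?_⟩
    · have h := hfin (primePlace p) 1
      rw [hres] at h
      exact (resOfLe_kerSubgroup_inf_decomp_eq_zero_iff_resOfLe_decomp_eq_zero W κ h4 y).1 h
    · have h := hfin v 1
      rw [hres] at h
      have hv' : ((p : ℕ) : 𝓞 ℚ) ∉ v.asIdeal := fun hm ↦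
        hv ((natCast_mem_asIdeal_iff_eq_primePlace p v).1 hm)
      exact (resOfLe_kerSubgroup_inf_decomp_eq_zero_iff_resOfLe_inertia_eq_zero W κ hκ hv' y).1 h
  · rintro ⟨hp0, hoff⟩
    refine ⟨fun v _ ↦ ?_, fun w _ ↦ subgroupH1_inf_decompInf_eq_zero W hp2 κ.kerSubgroup w _⟩
    rw [hres]
    by_cases hv : v = primePlace p
    · subst hv
      exact (resOfLe_kerSubgroup_inf_decomp_eq_zero_iff_resOfLe_decomp_eq_zero W κ h4 y).2 hp0
    · have hv' : ((p : ℕ) : 𝓞 ℚ) ∉ v.asIdeal := fun hm ↦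
        hv ((natCast_mem_asIdeal_iff_eq_primePlace p v).1 hm)
      exact (resOfLe_kerSubgroup_inf_decomp_eq_zero_iff_resOfLe_inertia_eq_zero W κ hκ hv' y).2
        (hoff v hv)


end Rat

end Summit.BirchSwinnertonDyer.BirchSwinnertonDyer.Theorems.ExactFineControlLocal

end
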